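import Summits.RiemannHypothesis.RiemannHypothesis.Theorems.PfPersistenceDefectiveTransportSeedFree
import HarnessLib

/-!
# The rate-zero rung of the transport ladder: coarse relative clauses and uniformly bounded drops
# from ANY base (leaf G1.22 TRANSPORT, part 7b)

pub-rhpf cell (mechanism/rigidity campaign; **no RH claims**), seat `pub-rhpf-transport-1` gen 7.
Companion of parts 6 (`…Coarse`) and 7a (`…SeedFree`).

Write `ε = weilGroundEnergy` (the bottom of Weil's quadratic functional on the window `[-a, a]`;
antitone in `a`).  Part 7a showed that an UNGUARDED relative law with non-negative rate freezes
negativity from any single base `b > 0` and is therefore RH, with no seed window.  This file records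
the fixed-step (coarse) versions, which need neither continuity nor a Dini clause, and closes the
`δ = 0` end of part 6's `coarse speed limit at rate δ ⟺ floor at rate δ ⟹ quasi-RH(δ/2)`:

1. **Coarse relative clause from one base** (`min_le_of_coarseRelative`,
   `ge_min_of_coarseRelative_anyBase`, `riemannHypothesis_of_coarseRelative_anyBase`): at a fixed
   step `s > 0`, `m x · ε x ≤ ε (x + s)` for `x ≥ b` with `0 ≤ m x ≤ 1` gives
   `ε a ≥ min (ε b) 0` for `a ≥ b` (lattice induction + antitonicity), hence RH.  No seed.
2. **The rate-zero rung, seed-free and elementary** (`riemannHypothesis_of_linear_floor`,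
   `riemannHypothesis_of_uniformCoarseSpeed_anyBase`, `riemannHypothesis_iff_uniformCoarseSpeed`,
   `riemannHypothesis_of_uniformSpeedLimit_anyBase`): RH holds iff over SOME fixed step the bottom
   has uniformly bounded drops eventually (`∃ b s C, 0 < b ∧ 0 < s ∧ ∀ x ≥ b, ε x − ε (x+s) ≤ C`;
   `→` is part 6's `coarseSpeed_le_of_riemannHypothesis`, `←` telescopes to a LINEAR floor, and a
   linear — indeed any sub-exponential — floor is RH by Solo's
   `riemannHypothesis_of_weilGroundEnergy_subexp`); a uniform one-sided Lipschitz constant in Dini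
   form from any base is RH (part 2's `riemannHypothesis_of_uniformSpeedLimitFrom` asked the seed
   `a₀ < (log 3)/2`; superfluous).  UNCONDITIONALLY the drops over a fixed step are bounded on every
   compact range (part 6's `coarseSpeedLimit_unconditional`, from `WindowLipschitz`); the RH-content
   is exactly the UNIFORMITY in `x → ∞`, and at rate `δ > 0` it is quasi-RH(δ/2) (part 6).

Every statement is elementary real analysis over tree theorems; every member is a typed HYPOTHESIS
(asserted nowhere) or an RH-labelled calibration (proof.conditional; credits nothing).  References:
E. Bombieri, *Remarks on Weil's quadratic functional in the theory of prime numbers I*, Rend. Mat.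
Acc. Lincei (9) 11 (2000) 183–233, §4; A. Connes, C. Consani, H. Moscovici, arXiv:2511.22755,
Cor. 3.7–3.8 (monotonicity of the bottom; "limit `0` ⟹ RH"). [folklore]
-/

noncomputable section

set_option linter.dupNamespace false  -- D-0017 nested layout: `RiemannHypothesis.RiemannHypothesis`

namespace Summit.RiemannHypothesis.RiemannHypothesis.Theorems.PfPersistenceDefectiveTransport

open Set
open _root_.Literature.NumberTheory.LFunctions
open _root_.Summit.RiemannHypothesis.RiemannHypothesis.Theorems.WeilWindowFlowWindowLipschitz
  (windowLipschitz_antitone)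

/-! ## 1. The coarse relative clause from one base -/

/-- **Lattice induction for a contractive multiplicative step.**  If `m x · f x ≤ f (x + s)` for all
`x ≥ b` with `0 ≤ m x ≤ 1` (`s ≥ 0`), then `min (f b) 0 ≤ f (b + n s)` for every `n`. [folklore] -/
theorem min_le_of_coarseRelative {f m : ℝ → ℝ} {b s : ℝ} (hs : 0 ≤ s)
    (hm0 : ∀ x : ℝ, b ≤ x → 0 ≤ m x) (hm1 : ∀ x : ℝ, b ≤ x → m x ≤ 1)
    (h : ∀ x : ℝ, b ≤ x → m x * f x ≤ f (x + s)) (n : ℕ) : min (f b) 0 ≤ f (b + n * s) := by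
  induction n with
  | zero => simp
  | succ n ih =>
    have hx : b ≤ b + n * s := by
      have := (n.cast_nonneg : (0 : ℝ) ≤ n)
      nlinarith
    have hstep := h (b + n * s) hx
    have e1 : b + n * s + s = b + ((n + 1 : ℕ) : ℝ) * s := by push_cast; ring
    rw [e1] at hstep
    rcases le_or_gt 0 (f (b + n * s)) with hf | hf
    · have h1 : 0 ≤ m (b + n * s) * f (b + n * s) := mul_nonneg (hm0 _ hx) hf
      have h2 : min (f b) 0 ≤ 0 := min_le_right _ _
      linarith
    · have h1 : 1 * f (b + n * s) ≤ m (b + n * s) * f (b + n * s) :=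
        mul_le_mul_of_nonpos_right (hm1 _ hx) hf.le
      linarith

/-- **Coarse relative clause from any base freezes negativity.**  If for some `b > 0`, step `s > 0`
and all `x ≥ b`: `m x · ε x ≤ ε (x + s)` with `0 ≤ m x ≤ 1`, then `min (ε b) 0 ≤ ε a` for all `a ≥ b`
(the lattice `b + ℕ s` and antitonicity inside each step).  CONDITIONAL; RH-free; no RH claim.
[folklore] -/
theorem ge_min_of_coarseRelative_anyBase {b s : ℝ} (hb : 0 < b) (hs : 0 < s) {m : ℝ → ℝ}
    (hm0 : ∀ x : ℝ, b ≤ x → 0 ≤ m x) (hm1 : ∀ x : ℝ, b ≤ x → m x ≤ 1)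
    (h : ∀ x : ℝ, b ≤ x → m x * weilGroundEnergy x ≤ weilGroundEnergy (x + s)) :
    ∀ a : ℝ, b ≤ a → min (weilGroundEnergy b) 0 ≤ weilGroundEnergy a := by
  intro a hba
  set n : ℕ := ⌈(a - b) / s⌉₊ with hn
  have hn1 : (a - b) / s ≤ n := Nat.le_ceil _
  have ha1 : a ≤ b + n * s := by
    have := mul_le_mul_of_nonneg_right hn1 hs.le
    rw [div_mul_cancel₀ _ hs.ne'] at this
    linarith
  have hanti : weilGroundEnergy (b + n * s) ≤ weilGroundEnergy a :=
    windowLipschitz_antitone (hb.trans_le hba) ha1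
  have htel := min_le_of_coarseRelative (f := weilGroundEnergy) hs.le hm0 hm1 h n
  linarith

/-- **Coarse relative clause from ANY base is RH** (`0 ≤ m ≤ 1`, one step `s > 0`, one base `b > 0`;
no seed, no continuity, no Dini clause).  CONDITIONAL; no RH claim. [folklore] -/
theorem riemannHypothesis_of_coarseRelative_anyBase {b s : ℝ} (hb : 0 < b) (hs : 0 < s) {m : ℝ → ℝ}
    (hm0 : ∀ x : ℝ, b ≤ x → 0 ≤ m x) (hm1 : ∀ x : ℝ, b ≤ x → m x ≤ 1)
    (h : ∀ x : ℝ, b ≤ x → m x * weilGroundEnergy x ≤ weilGroundEnergy (x + s)) :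
    _root_.RiemannHypothesis :=
  riemannHypothesis_of_eventual_const_floor hb (C := -min (weilGroundEnergy b) 0) fun a hba ↦ by
    have h1 := ge_min_of_coarseRelative_anyBase hb hs hm0 hm1 h a hba
    linarith

/-! ## 2. The rate-zero rung: uniformly bounded drops ⟺ RH (seed-free, elementary) -/

/-- **Telescoping a uniform step bound.**  `f x − f (x + s) ≤ C` for all `x ≥ b` (`s ≥ 0`) gives
`f b − n C ≤ f (b + n s)`. [folklore] -/
theorem sub_lin_le_of_uniformCoarse {f : ℝ → ℝ} {b C s : ℝ} (hs : 0 ≤ s)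
    (h : ∀ x : ℝ, b ≤ x → f x - f (x + s) ≤ C) (n : ℕ) : f b - n * C ≤ f (b + n * s) := by
  induction n with
  | zero => simp
  | succ n ih =>
    have hx : b ≤ b + n * s := by
      have := (n.cast_nonneg : (0 : ℝ) ≤ n)
      nlinarith
    have hstep := h (b + n * s) hx
    have e1 : b + n * s + s = b + ((n + 1 : ℕ) : ℝ) * s := by push_cast; ring
    rw [e1] at hstep
    have e2 : ((n + 1 : ℕ) : ℝ) * C = n * C + C := by push_cast; ring
    linarith

/-- **A LINEAR floor is RH**: if `−(A + B a) ≤ ε a` for all `a ≥ b` (`b > 0`), then RH (a linear slack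
is sub-exponential slack: `A + B a ≤ (max A 0 + max B 0 / κ) e^{κa}` for every `κ > 0`; Solo's
`riemannHypothesis_of_weilGroundEnergy_subexp`).  CONDITIONAL; proof.conditional; no RH claim.
[folklore] -/
theorem riemannHypothesis_of_linear_floor {b A B : ℝ} (hb : 0 < b)
    (h : ∀ a : ℝ, b ≤ a → -(A + B * a) ≤ weilGroundEnergy a) : _root_.RiemannHypothesis := by
  refine riemannHypothesis_of_weilGroundEnergy_subexp fun κ hκ ↦
    ⟨max A 0 + max B 0 / κ, b, fun a hba ↦ ?_⟩
  have ha : 0 ≤ a := hb.le.trans hba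
  have h1 : (1 : ℝ) ≤ Real.exp (κ * a) := Real.one_le_exp (by positivity)
  have h2 : κ * a ≤ Real.exp (κ * a) := by linarith [Real.add_one_le_exp (κ * a)]
  have h3 : a ≤ Real.exp (κ * a) / κ := by
    rw [le_div_iff₀ hκ]
    linarith
  have h4 : A ≤ max A 0 * Real.exp (κ * a) :=
    (le_max_left _ _).trans (le_mul_of_one_le_right (le_max_right _ _) h1)
  have h5 : B * a ≤ max B 0 / κ * Real.exp (κ * a) :=
    calc B * a ≤ max B 0 * a := mul_le_mul_of_nonneg_right (le_max_left _ _) ha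
      _ ≤ max B 0 * (Real.exp (κ * a) / κ) := mul_le_mul_of_nonneg_left h3 (le_max_right _ _)
      _ = max B 0 / κ * Real.exp (κ * a) := by ring
  have e : (max A 0 + max B 0 / κ) * Real.exp (κ * a) =
      max A 0 * Real.exp (κ * a) + max B 0 / κ * Real.exp (κ * a) := by ring
  rw [e]
  linarith [h a hba]

/-- **Uniformly bounded drops over ONE step, from ANY base ⟹ RH.**  If for some `b > 0`, `s > 0`,
`C` and all `x ≥ b`: `ε x − ε (x + s) ≤ C`, then RH (telescoping gives the linear floor
`ε a ≥ ε b − ((a − b)/s + 1) C`).  The `δ = 0` end of part 6's `coarseSpeedLimit_iff_floor`; no seed,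
no `WindowLipschitz`.  CONDITIONAL; no RH claim. [folklore] -/
theorem riemannHypothesis_of_uniformCoarseSpeed_anyBase {b s C : ℝ} (hb : 0 < b) (hs : 0 < s)
    (h : ∀ x : ℝ, b ≤ x → weilGroundEnergy x - weilGroundEnergy (x + s) ≤ C) :
    _root_.RiemannHypothesis := by
  have hC : 0 ≤ C := by
    have h1 := h b le_rfl
    have h2 : weilGroundEnergy (b + s) ≤ weilGroundEnergy b :=
      windowLipschitz_antitone hb (by linarith)
    linarith
  refine riemannHypothesis_of_linear_floor hb
    (A := -weilGroundEnergy b + C - C * b / s) (B := C / s) fun a hba ↦ ?_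
  set n : ℕ := ⌈(a - b) / s⌉₊ with hn
  have hn1 : (a - b) / s ≤ n := Nat.le_ceil _
  have hn2 : (n : ℝ) < (a - b) / s + 1 := Nat.ceil_lt_add_one (div_nonneg (by linarith) hs.le)
  have ha1 : a ≤ b + n * s := by
    have := mul_le_mul_of_nonneg_right hn1 hs.le
    rw [div_mul_cancel₀ _ hs.ne'] at this
    linarith
  have hanti : weilGroundEnergy (b + n * s) ≤ weilGroundEnergy a :=
    windowLipschitz_antitone (hb.trans_le hba) ha1
  have htel := sub_lin_le_of_uniformCoarse (f := weilGroundEnergy) hs.le h n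
  have h6 : (n : ℝ) * C ≤ ((a - b) / s + 1) * C := mul_le_mul_of_nonneg_right hn2.le hC
  have e : ((a - b) / s + 1) * C = C / s * a - C * b / s + C := by ring
  rw [e] at h6
  linarith

/-- **RH ⟺ uniformly bounded drops over some step, eventually**:
`RH ↔ ∃ b s C, 0 < b ∧ 0 < s ∧ ∀ x ≥ b, ε x − ε (x + s) ≤ C`.  (`→`: part 6's
`coarseSpeed_le_of_riemannHypothesis`, `C = ε 1`; `←`: the theorem above.)  Both directions
elementary; no seed; no `WindowLipschitz`.  proof.conditional; credits nothing; no RH claim.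
[folklore] -/
theorem riemannHypothesis_iff_uniformCoarseSpeed :
    _root_.RiemannHypothesis ↔
      ∃ b s C : ℝ, 0 < b ∧ 0 < s ∧ ∀ x : ℝ, b ≤ x →
        weilGroundEnergy x - weilGroundEnergy (x + s) ≤ C := by
  constructor
  · intro hRH
    exact ⟨1, 1, weilGroundEnergy 1, one_pos, one_pos,
      coarseSpeed_le_of_riemannHypothesis hRH one_pos zero_le_one⟩
  · rintro ⟨b, s, C, hb, hs, h⟩
    exact riemannHypothesis_of_uniformCoarseSpeed_anyBase hb hs h

/-- **A UNIFORM one-sided Lipschitz constant from ANY base is RH** (lower-right-Dini form: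
`ε x − ε (x + h) ≤ h (L + η)` for arbitrarily small `h > 0` at every `x ≥ b`): the speed limit at every
rate `δ > 0` with constant `L` follows (`L ≤ L e^{δx}`), hence RH by part 4's
`riemannHypothesis_of_subexpSpeed`.  Part 2's `riemannHypothesis_of_uniformSpeedLimitFrom` asked the
seed `a₀ < (log 3)/2`; it is superfluous.  CONDITIONAL; no RH claim. [folklore] -/
theorem riemannHypothesis_of_uniformSpeedLimit_anyBase {b L : ℝ} (hb : 0 < b) (hL : 0 ≤ L)
    (h : ∀ x : ℝ, b ≤ x → ∀ η δ' : ℝ, 0 < η → 0 < δ' →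
      ∃ h : ℝ, 0 < h ∧ h < δ' ∧ weilGroundEnergy x - weilGroundEnergy (x + h) ≤ h * (L + η)) :
    _root_.RiemannHypothesis :=
  riemannHypothesis_of_subexpSpeed fun δ hδ ↦ ⟨b, L, hb, hL, fun x hx η δ' hη hδ' ↦ by
    obtain ⟨h, hpos, hlt, hle⟩ := h x hx η δ' hη hδ'
    refine ⟨h, hpos, hlt, hle.trans (mul_le_mul_of_nonneg_left ?_ hpos.le)⟩
    have h1 : 1 ≤ Real.exp (δ * x) := Real.one_le_exp (by nlinarith [hb.trans_le hx])
    nlinarith⟩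

end Summit.RiemannHypothesis.RiemannHypothesis.Theorems.PfPersistenceDefectiveTransport

end
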